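import Literature.NumberTheory.Automorphic.MeyerDifferenceRepresentation
import Mathlib.Analysis.Calculus.ContDiff.Bounds
import HarnessLib

/-!
# Archimedean orbit calculus on the idele class group (for Meyer's weighted Schwartz spaces)

Topic `NumberTheory/Automorphic`; namespace `Literature.NumberTheory.Automorphic.Meyer`. Proof file
(theorems only) on top of `MeyerDifferenceRepresentation`, preparing the proof of
`Meyer.piPlus_two_dimensional` (R. Meyer, Duke Math. J. 127 (2005), §1 p. 5 and Lemma 5.5
[Meyer2005]). The Bruhat–Schwartz space `𝒮(C_K)` of the tree (`Meyer.IsIdeleClassSchwartz`: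
invariance under an open subgroup of the finite idele units, smoothness of the archimedean orbit
maps `X ↦ f(x · exp X)` on `K_∞ ≅ ℝ^{r₁} × ℂ^{r₂}`, and decay of all their derivatives at `X = 0`
against the weights `(1 + |log |x||)^β`) and its weighted versions `𝒮(C_K)_I` [Meyer2005, Def. 4.1]
are studied through the one-parameter subgroups:

* `mixedExpUnit_add`, `archExpClass_add`, `archOrbit_add_apply`,
  `contDiff_archOrbit_of_contDiffAt_zero` — the archimedean exponential is a homomorphism, so the
  orbit map at `x` near `X₀` is the orbit map at `x · exp X₀` near `0`: smoothness at `0` for all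
  `x` is smoothness everywhere;
* `exists_classNorm_archExpClass_eq_exp` — `|exp X| = e^{L(X)}` for a continuous linear form `L`
  (`L(X) = Σ_{w real} X_w + 2 Σ_{w complex} Re X_w`), whence the weights `|x exp X|^α` are smooth in
  `X`;
* `archOrbit_weightMul` and `norm_iteratedFDeriv_archOrbit_weightMul_le` — the orbit map of
  `f · |x|^α` is `|x|^α · (orbit map of f) · e^{α L}`, with the Leibniz bound on its derivatives;
* `weightMul_mem_ideleClassSchwartz_of_bounds` — **criterion**: if `f · |x|^α` is invariant under
  an open subgroup of the finite idele units, the orbit maps of `f` are smooth at `0`, and their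
  `n`-th derivatives at `0` are `O(|x|^{-s₁})` and `O(|x|^{-s₂})` with `s₁ < α < s₂`, then
  `f · |x|^α ∈ 𝒮(C_K)` (the logarithmic weights are absorbed by `|x|^{±ε}`);
* `comp_inv_mem_ideleClassSchwartz`, `invJ_mem_ideleClassSchwartzWeighted` — **`𝒮(C_K)` is stable
  under `f ↦ f(x⁻¹)` and `J` maps `𝒮(C_K)_{(1,∞)}` to `𝒮(C_K)_{(-∞,0)}`** (Meyer (2005), proof of
  Lemma 5.4: "`J : 𝒮(C_S)₊ ≅ 𝒮(C_S)₋` is a bornological isomorphism");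
* `mem_Hminus_of_mem_weighted_Ioi_of_mem_weighted_Iio` — **interpolation**:
  `𝒮(C_K)_{(1,∞)} ∩ 𝒮(C_K)_{(-∞,0)} ⊆ 𝒮(C_K)_ℝ = H₋` (Meyer (2005), §4.1: `𝒮(G)_I` only depends on
  the convex hull of `I`).

No topology or bornology is involved: all statements are about the algebraic function spaces of
the tree. Folklore apart from the cited design of [Meyer2005].

## References

* R. Meyer, *On a representation of the idele class group related to primes and zeros of
  L-functions*, Duke Math. J. 127 (2005), 519–595, §4.1 and §5.3–5.5 [Meyer2005].
-/

noncomputable section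

open MeasureTheory NumberField NumberField.InfinitePlace NumberField.mixedEmbedding IsDedekindDomain
  Filter Set
open scoped NNReal ENNReal ContDiff Topology Classical

namespace Literature.NumberTheory.Automorphic.Meyer

variable (K : Type) [Field K] [NumberField K]

/-! ### The archimedean exponential and the orbit maps -/

section Exp

omit [NumberField K] in
/-- The underlying point of `mixedExpUnit K X` is the componentwise exponential. [folklore] -/
theorem mixedExpUnit_val (X : mixedSpace K) :
    ((mixedExpUnit K X : (mixedSpace K)ˣ) : mixedSpace K) =
      (fun w => Real.exp (X.1 w), fun w => Complex.exp (X.2 w)) := rfl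

/-- The componentwise exponential `K_∞ → K_∞` is smooth. [folklore] -/
theorem contDiff_mixedExpUnit_val {n : WithTop ℕ∞} :
    ContDiff ℝ n fun X : mixedSpace K => ((mixedExpUnit K X : (mixedSpace K)ˣ) : mixedSpace K) := by
  change ContDiff ℝ n fun X : mixedSpace K =>
    ((fun w => Real.exp (X.1 w), fun w => Complex.exp (X.2 w)) : mixedSpace K)
  refine ContDiff.prodMk ?_ ?_
  · exact contDiff_pi.2 fun w => Real.contDiff_exp.comp ((contDiff_apply ℝ ℝ w).comp contDiff_fst)
  · exact contDiff_pi.2 fun w =>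
      Complex.contDiff_exp.comp ((contDiff_apply ℝ ℂ w).comp contDiff_snd)

omit [NumberField K] in
/-- The componentwise exponential is a homomorphism `(K_∞, +) → K_∞ˣ`. [folklore] -/
theorem mixedExpUnit_add (X Y : mixedSpace K) :
    mixedExpUnit K (X + Y) = mixedExpUnit K X * mixedExpUnit K Y := by
  refine Units.ext ?_
  rw [Units.val_mul, mixedExpUnit_val, mixedExpUnit_val, mixedExpUnit_val]
  refine Prod.ext (funext fun w => ?_) (funext fun w => ?_)
  · simp [Real.exp_add]
  · simp [Complex.exp_add]

omit [NumberField K] in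
/-- `exp 0 = 1`. [folklore] -/
@[simp]
theorem mixedExpUnit_zero : mixedExpUnit K (0 : mixedSpace K) = 1 := by
  refine Units.ext ?_
  rw [mixedExpUnit_val, Units.val_one]
  refine Prod.ext (funext fun w => ?_) (funext fun w => ?_)
  · simp
  · simp

/-- The archimedean one-parameter classes form a homomorphism `(K_∞, +) → C_K`. [folklore] -/
theorem archExpClass_add (X Y : mixedSpace K) :
    archExpClass K (X + Y) = archExpClass K X * archExpClass K Y := by
  simp only [archExpClass, mixedExpUnit_add, map_mul]

/-- The class of `exp 0` is trivial. [folklore] -/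
@[simp]
theorem archExpClass_zero : archExpClass K (0 : mixedSpace K) = 1 := by
  simp only [archExpClass, mixedExpUnit_zero, map_one]

/-- `exp(-X)` is the inverse class. [folklore] -/
theorem archExpClass_neg (X : mixedSpace K) : archExpClass K (-X) = (archExpClass K X)⁻¹ := by
  refine eq_inv_of_mul_eq_one_left ?_
  rw [← archExpClass_add, neg_add_cancel, archExpClass_zero]

variable {K}

/-- Unfolding of the orbit map. [folklore] -/
theorem archOrbit_apply (f : IdeleClassGroup K → ℂ) (x : IdeleClassGroup K) (X : mixedSpace K) :
    archOrbit K f x X = f (x * archExpClass K X) := rfl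

/-- The orbit map at `0` is the value. [folklore] -/
@[simp]
theorem archOrbit_apply_zero (f : IdeleClassGroup K → ℂ) (x : IdeleClassGroup K) :
    archOrbit K f x 0 = f x := by
  rw [archOrbit_apply, archExpClass_zero]
  exact congrArg f (mul_one x)

/-- **Shifting the orbit map**: `f(x · exp(X₀ + Y)) = f((x · exp X₀) · exp Y)`. [folklore] -/
theorem archOrbit_add_apply (f : IdeleClassGroup K → ℂ) (x : IdeleClassGroup K) (X₀ Y : mixedSpace K) :
    archOrbit K f x (X₀ + Y) = archOrbit K f (x * archExpClass K X₀) Y := by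
  simp only [archOrbit_apply, archExpClass_add, mul_assoc]

/-- The orbit map at `x` is the orbit map at `x · exp X₀` composed with the translation by `-X₀`.
[folklore] -/
theorem archOrbit_eq_comp_sub (f : IdeleClassGroup K → ℂ) (x : IdeleClassGroup K) (X₀ : mixedSpace K) :
    archOrbit K f x = archOrbit K f (x * archExpClass K X₀) ∘ fun X => X - X₀ := by
  funext X
  rw [Function.comp_apply, ← archOrbit_add_apply, add_sub_cancel]

/-- **Smoothness of the orbit maps at `0` for all base points is smoothness everywhere** (the
exponential charts of the Lie group `C_K / k` differ by translations). [folklore] -/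
theorem contDiff_archOrbit_of_contDiffAt_zero {f : IdeleClassGroup K → ℂ} {n : WithTop ℕ∞}
    (h : ∀ x, ContDiffAt ℝ n (archOrbit K f x) 0) (x : IdeleClassGroup K) :
    ContDiff ℝ n (archOrbit K f x) := by
  refine contDiff_iff_contDiffAt.2 fun X₀ => ?_
  rw [archOrbit_eq_comp_sub f x X₀]
  have h2 : ContDiffAt ℝ n (fun X : mixedSpace K => X - X₀) X₀ := contDiffAt_id.sub contDiffAt_const
  have h1 : ContDiffAt ℝ n (archOrbit K f (x * archExpClass K X₀)) ((fun X : mixedSpace K => X - X₀) X₀) := by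
    have h0 : (fun X : mixedSpace K => X - X₀) X₀ = 0 := sub_self X₀
    rw [h0]
    exact h _
  exact ContDiffAt.comp (f := fun X : mixedSpace K => X - X₀) X₀ h1 h2

/-- The orbit map of `f ∘ (·)⁻¹` at `x` is the orbit map of `f` at `x⁻¹` composed with `X ↦ -X`.
[folklore] -/
theorem archOrbit_comp_inv (f : IdeleClassGroup K → ℂ) (x : IdeleClassGroup K) :
    archOrbit K (fun y => f y⁻¹) x = archOrbit K f x⁻¹ ∘ Neg.neg := by
  funext X
  simp only [archOrbit_apply, Function.comp_apply, archExpClass_neg]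
  exact congrArg f (mul_inv x (archExpClass K X))

/-- The orbit map of a translate. [folklore] -/
theorem archOrbit_mul_left (f : IdeleClassGroup K → ℂ) (g x : IdeleClassGroup K) :
    archOrbit K (fun y => f (g * y)) x = archOrbit K f (g * x) := by
  funext X
  simp only [archOrbit_apply, mul_assoc]

end Exp

/-! ### The norm of the archimedean exponential -/

section Norm

/-- The product of the local norms of an infinite adele over all infinite places, with
multiplicities, is Mathlib's `mixedEmbedding.norm` of its image in the mixed space (the
isomorphism `K_w ≅ ℝ`, `K_w ≅ ℂ` being isometric). (Also `mixedEmbedding_norm_ringEquiv_mixedSpace`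
of `GLnArchimedeanFactor`, not imported here.) [folklore] -/
theorem prod_norm_pow_mult_eq_norm_ringEquiv_mixedSpace (t : InfiniteAdeleRing K) :
    ∏ w : InfinitePlace K, ‖t w‖ ^ w.mult =
      mixedEmbedding.norm (InfiniteAdeleRing.ringEquiv_mixedSpace K t) := by
  rw [mixedEmbedding.norm_apply]
  refine Finset.prod_congr rfl fun w _ => ?_
  congr 1
  by_cases hw : w.IsReal
  · rw [normAtPlace_apply_of_isReal hw, InfiniteAdeleRing.ringEquiv_mixedSpace_apply]
    exact ((InfinitePlace.Completion.isometry_extensionEmbeddingOfIsReal hw).norm_map_of_map_zero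
      (map_zero _) _).symm
  · have hw' : w.IsComplex := not_isReal_iff_isComplex.1 hw
    rw [normAtPlace_apply_of_isComplex hw', InfiniteAdeleRing.ringEquiv_mixedSpace_apply]
    exact ((InfinitePlace.Completion.isometry_extensionEmbedding w).norm_map_of_map_zero
      (map_zero _) _).symm

/-- The idele class norm of the class of an infinite idele `(t, 1)` is `∏_w ‖t_w‖^{[K_w:ℝ]}`.
[folklore] -/
theorem classNorm_mk_infiniteIdeles (t : (InfiniteAdeleRing K)ˣ) :
    classNorm K (IdeleClassGroup.mk K (GaloisRepresentations.infiniteIdeles K t)) =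
      ∏ w : InfinitePlace K, ‖(t : InfiniteAdeleRing K) w‖ ^ w.mult := by
  change ((IdeleClassGroup.ideleNorm K (GaloisRepresentations.infiniteIdeles K t) : ℝ≥0) : ℝ) = _
  rw [coe_ideleNorm, GaloisRepresentations.ideleNorm]
  have h2 : ∀ v : HeightOneSpectrum (𝓞 K),
      ‖((GaloisRepresentations.infiniteIdeles K t : GaloisRepresentations.ideleGroup K) :
        AdeleRing (𝓞 K) K).2 v‖ = 1 := fun v => by
    rw [show ((GaloisRepresentations.infiniteIdeles K t : GaloisRepresentations.ideleGroup K) :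
        AdeleRing (𝓞 K) K).2 v = 1 from rfl, norm_one]
  rw [finprod_eq_one_of_forall_eq_one h2, mul_one]
  rfl

/-- **The norm of the archimedean exponential**: `|exp X| = ∏_{w real} e^{X_w} · ∏_{w complex}
e^{2 Re X_w}`. [folklore] -/
theorem classNorm_archExpClass (X : mixedSpace K) :
    classNorm K (archExpClass K X) =
      (∏ w : {w : InfinitePlace K // w.IsReal}, Real.exp (X.1 w)) *
        ∏ w : {w : InfinitePlace K // w.IsComplex}, Real.exp (2 * (X.2 w).re) := by
  rw [archExpClass, classNorm_mk_infiniteIdeles, prod_norm_pow_mult_eq_norm_ringEquiv_mixedSpace]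
  have hval : ((Units.map ((InfiniteAdeleRing.ringEquiv_mixedSpace K).symm :
      mixedSpace K ≃+* InfiniteAdeleRing K).toMonoidHom (mixedExpUnit K X) :
        (InfiniteAdeleRing K)ˣ) : InfiniteAdeleRing K) =
      (InfiniteAdeleRing.ringEquiv_mixedSpace K).symm (mixedExpUnit K X : mixedSpace K) := rfl
  rw [hval, RingEquiv.apply_symm_apply, mixedExpUnit_val, mixedEmbedding.norm_apply,
    prod_eq_prod_mul_prod]
  congr 1
  · refine Finset.prod_congr rfl fun w _ => ?_
    rw [normAtPlace_apply_of_isReal w.2, mult_isReal, pow_one, Real.norm_eq_abs, Real.abs_exp]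
  · refine Finset.prod_congr rfl fun w _ => ?_
    rw [normAtPlace_apply_of_isComplex w.2, mult_isComplex, Complex.norm_exp, ← Real.exp_nat_mul]
    norm_num

/-- **The norm of the archimedean exponential is the exponential of a linear form**:
`|exp X| = e^{L(X)}`, `L(X) = Σ_{w real} X_w + 2 Σ_{w complex} Re X_w`. [folklore] -/
theorem exists_classNorm_archExpClass_eq_exp :
    ∃ L : mixedSpace K →L[ℝ] ℝ, ∀ X : mixedSpace K, classNorm K (archExpClass K X) = Real.exp (L X) := by
  let L₁ : mixedSpace K →L[ℝ] ℝ :=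
    ∑ w : {w : InfinitePlace K // w.IsReal},
      (ContinuousLinearMap.proj w).comp (ContinuousLinearMap.fst ℝ _ _)
  let L₂ : mixedSpace K →L[ℝ] ℝ :=
    ∑ w : {w : InfinitePlace K // w.IsComplex},
      (2 : ℝ) • (Complex.reCLM.comp ((ContinuousLinearMap.proj w).comp (ContinuousLinearMap.snd ℝ _ _)))
  refine ⟨L₁ + L₂, fun X => ?_⟩
  rw [classNorm_archExpClass]
  change _ = Real.exp (L₁ X + L₂ X)
  rw [Real.exp_add]
  congr 1
  · rw [← Real.exp_sum]
    congr 1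
    simp [L₁]
  · rw [← Real.exp_sum]
    congr 1
    simp [L₂]

/-- The weights `X ↦ |exp X|^α` are smooth on `K_∞`. [folklore] -/
theorem contDiff_classNorm_archExpClass_rpow (α : ℝ) {n : WithTop ℕ∞} :
    ContDiff ℝ n fun X : mixedSpace K => classNorm K (archExpClass K X) ^ α := by
  obtain ⟨L, hL⟩ := exists_classNorm_archExpClass_eq_exp K
  have h : (fun X : mixedSpace K => classNorm K (archExpClass K X) ^ α) =
      fun X => Real.exp (α * L X) := by
    funext X
    rw [hL X, ← Real.exp_mul, mul_comm]
  rw [h]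
  exact Real.contDiff_exp.comp (contDiff_const.mul L.contDiff)

/-- The complex-valued weights `X ↦ (|exp X|^α : ℂ)` are smooth on `K_∞`. [folklore] -/
theorem contDiff_ofReal_classNorm_archExpClass_rpow (α : ℝ) {n : WithTop ℕ∞} :
    ContDiff ℝ n fun X : mixedSpace K => ((classNorm K (archExpClass K X) ^ α : ℝ) : ℂ) :=
  Complex.ofRealCLM.contDiff.comp (contDiff_classNorm_archExpClass_rpow K α)

end Norm

/-! ### Weights along the orbit maps and the Leibniz bound -/

section Weight

variable {K}

/-- `weightMul 0 = id`: `f · |x|^0 = f`. [folklore] -/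
theorem weightMul_zero_eq (f : IdeleClassGroup K → ℂ) : weightMul K 0 f = f := by
  funext x
  rw [weightMul_apply, Real.rpow_zero, Complex.ofReal_one, mul_one]

/-- `(f · |x|^b) · |x|^a = f · |x|^{a+b}`. [folklore] -/
theorem weightMul_weightMul (a b : ℝ) (f : IdeleClassGroup K → ℂ) :
    weightMul K a (weightMul K b f) = weightMul K (a + b) f := by
  funext x
  simp only [weightMul_apply]
  rw [Real.rpow_add (classNorm_pos x)]
  push_cast
  ring

/-- **The orbit map of `f · |x|^α`** is `|x|^α · (orbit map of `f`) · |exp X|^α`. [folklore] -/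
theorem archOrbit_weightMul (α : ℝ) (f : IdeleClassGroup K → ℂ) (x : IdeleClassGroup K) :
    archOrbit K (weightMul K α f) x =
      ((classNorm K x ^ α : ℝ) : ℂ) • fun X =>
        archOrbit K f x X * ((classNorm K (archExpClass K X) ^ α : ℝ) : ℂ) := by
  funext X
  rw [Pi.smul_apply, smul_eq_mul, archOrbit_apply, weightMul_apply, classNorm_mul,
    Real.mul_rpow (classNorm_pos _).le (classNorm_pos _).le, archOrbit_apply]
  push_cast
  ring

/-- The orbit maps of `f · |x|^α` are smooth when those of `f` are. [folklore] -/
theorem contDiff_archOrbit_weightMul {f : IdeleClassGroup K → ℂ} {x : IdeleClassGroup K}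
    {n : WithTop ℕ∞} (hf : ContDiff ℝ n (archOrbit K f x)) (α : ℝ) :
    ContDiff ℝ n (archOrbit K (weightMul K α f) x) := by
  rw [archOrbit_weightMul]
  exact (hf.mul (contDiff_ofReal_classNorm_archExpClass_rpow K α)).const_smul
    (((classNorm K x ^ α : ℝ) : ℂ))

/-- A sum with non-negative weights is bounded by the total weight times the sum:
`∑ a_i b_i ≤ (∑ b_i) · ∑ a_i` for `a_i, b_i ≥ 0`. [folklore] -/
theorem sum_mul_le_sum_mul_sum {ι : Type*} (s : Finset ι) {a b : ι → ℝ} (ha : ∀ i ∈ s, 0 ≤ a i)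
    (hb : ∀ i ∈ s, 0 ≤ b i) : ∑ i ∈ s, a i * b i ≤ (∑ i ∈ s, b i) * ∑ i ∈ s, a i := by
  rw [Finset.mul_sum]
  refine Finset.sum_le_sum fun i hi => ?_
  rw [mul_comm]
  exact mul_le_mul_of_nonneg_right (Finset.single_le_sum hb hi) (ha i hi)

variable (K) in
/-- **Leibniz bound for the weighted orbit maps**: for every `α` and `n` there is `C ≥ 0` with
`‖∂ⁿ_X (f·|·|^α)(x exp X)|₀‖ ≤ |x|^α · C · Σ_{i ≤ n} ‖∂ⁱ_X f(x exp X)|₀‖` for all `f` with smooth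
orbit maps and all `x ∈ C_K`. [folklore] -/
theorem exists_norm_iteratedFDeriv_archOrbit_weightMul_le (α : ℝ) (n : ℕ) :
    ∃ C : ℝ, 0 ≤ C ∧ ∀ (f : IdeleClassGroup K → ℂ) (x : IdeleClassGroup K),
      ContDiff ℝ ∞ (archOrbit K f x) →
        ‖iteratedFDeriv ℝ n (archOrbit K (weightMul K α f) x) 0‖ ≤
          classNorm K x ^ α * (C * ∑ i ∈ Finset.range (n + 1), ‖iteratedFDeriv ℝ i (archOrbit K f x) 0‖) := by
  set w : mixedSpace K → ℂ := fun X => ((classNorm K (archExpClass K X) ^ α : ℝ) : ℂ) with hw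
  have hwc : ContDiff ℝ ∞ w := contDiff_ofReal_classNorm_archExpClass_rpow K α
  set C : ℝ := ∑ i ∈ Finset.range (n + 1), (n.choose i : ℝ) * ‖iteratedFDeriv ℝ (n - i) w 0‖ with hC
  have hC0 : 0 ≤ C := Finset.sum_nonneg fun i _ => by positivity
  refine ⟨C, hC0, fun f x hf => ?_⟩
  have hprod : ContDiff ℝ ∞ fun X => archOrbit K f x X * w X := hf.mul hwc
  rw [archOrbit_weightMul, iteratedFDeriv_const_smul_apply
    (hprod.contDiffAt.of_le (by exact_mod_cast le_top)), _root_.norm_smul,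
    Complex.norm_real, Real.norm_of_nonneg (Real.rpow_nonneg (classNorm_pos x).le α)]
  refine mul_le_mul_of_nonneg_left ?_ (Real.rpow_nonneg (classNorm_pos x).le α)
  calc ‖iteratedFDeriv ℝ n (fun X => archOrbit K f x X * w X) 0‖
      ≤ ∑ i ∈ Finset.range (n + 1), (n.choose i : ℝ) * ‖iteratedFDeriv ℝ i (archOrbit K f x) 0‖ *
          ‖iteratedFDeriv ℝ (n - i) w 0‖ :=
        norm_iteratedFDeriv_mul_le hf hwc 0 (by exact_mod_cast le_top)
    _ = ∑ i ∈ Finset.range (n + 1), ‖iteratedFDeriv ℝ i (archOrbit K f x) 0‖ *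
          ((n.choose i : ℝ) * ‖iteratedFDeriv ℝ (n - i) w 0‖) :=
        Finset.sum_congr rfl fun i _ => by ring
    _ ≤ C * ∑ i ∈ Finset.range (n + 1), ‖iteratedFDeriv ℝ i (archOrbit K f x) 0‖ :=
        sum_mul_le_sum_mul_sum _ (fun i _ => norm_nonneg _) fun i _ => by positivity

end Weight

/-! ### Absorbing the logarithmic weights -/

section LogWeight

/-- **Powers of `log` are absorbed by powers**: for `ε > 0` and `β ∈ ℕ` there is `A` with
`(1 + log t)^β t^{-ε} ≤ A` for all `t ≥ 1` (from `log t ≤ t^δ/δ`, `δ = ε/(β+1)`). [folklore] -/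
theorem exists_one_add_log_pow_mul_rpow_neg_le (β : ℕ) {ε : ℝ} (hε : 0 < ε) :
    ∃ A : ℝ, ∀ t : ℝ, 1 ≤ t → (1 + |Real.log t|) ^ β * t ^ (-ε) ≤ A := by
  set δ : ℝ := ε / (β + 1) with hδ
  have hβ1 : (0 : ℝ) < β + 1 := by positivity
  have hδ0 : 0 < δ := div_pos hε hβ1
  have hδβ : δ * β ≤ ε := by
    rw [hδ, div_mul_eq_mul_div, div_le_iff₀ hβ1]
    nlinarith
  refine ⟨(1 + 1 / δ) ^ β, fun t ht => ?_⟩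
  have ht0 : 0 < t := one_pos.trans_le ht
  have hlog : |Real.log t| ≤ t ^ δ / δ := by
    rw [abs_of_nonneg (Real.log_nonneg ht)]
    exact Real.log_le_rpow_div ht0.le hδ0
  have htδ : 1 ≤ t ^ δ := Real.one_le_rpow ht hδ0.le
  have h1 : 1 + |Real.log t| ≤ t ^ δ * (1 + 1 / δ) := by
    rw [mul_add, mul_one, mul_one_div]
    exact add_le_add htδ hlog
  have h2 : (1 + |Real.log t|) ^ β ≤ t ^ (δ * β) * (1 + 1 / δ) ^ β := by
    calc (1 + |Real.log t|) ^ β ≤ (t ^ δ * (1 + 1 / δ)) ^ β :=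
          pow_le_pow_left₀ (by positivity) h1 β
      _ = t ^ (δ * β) * (1 + 1 / δ) ^ β := by
          rw [mul_pow, ← Real.rpow_natCast (t ^ δ) β, ← Real.rpow_mul ht0.le]
  have h3 : t ^ (δ * β) * t ^ (-ε) ≤ 1 := by
    rw [← Real.rpow_add ht0]
    exact Real.rpow_le_one_of_one_le_of_nonpos ht (by linarith)
  calc (1 + |Real.log t|) ^ β * t ^ (-ε)
      ≤ t ^ (δ * β) * (1 + 1 / δ) ^ β * t ^ (-ε) :=
        mul_le_mul_of_nonneg_right h2 (Real.rpow_nonneg ht0.le _)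
    _ = (1 + 1 / δ) ^ β * (t ^ (δ * β) * t ^ (-ε)) := by ring
    _ ≤ (1 + 1 / δ) ^ β * 1 := mul_le_mul_of_nonneg_left h3 (by positivity)
    _ = (1 + 1 / δ) ^ β := mul_one _

/-- The same on `(0, 1]`: `(1 + |log t|)^β t^{ε} ≤ A` for `0 < t ≤ 1` (substitute `t ↦ t⁻¹`).
[folklore] -/
theorem exists_one_add_log_pow_mul_rpow_le (β : ℕ) {ε : ℝ} (hε : 0 < ε) :
    ∃ A : ℝ, ∀ t : ℝ, 0 < t → t ≤ 1 → (1 + |Real.log t|) ^ β * t ^ ε ≤ A := by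
  obtain ⟨A, hA⟩ := exists_one_add_log_pow_mul_rpow_neg_le β hε
  refine ⟨A, fun t ht0 ht1 => ?_⟩
  have h := hA t⁻¹ (one_le_inv_iff₀.2 ⟨ht0, ht1⟩)
  rwa [Real.log_inv, abs_neg, Real.inv_rpow ht0.le, ← Real.rpow_neg ht0.le, neg_neg] at h

variable {K}

/-- **Two-sided power bounds absorb the logarithmic weights**: if `0 ≤ φ(x) ≤ C₁ |x|^{-s₁}` and
`φ(x) ≤ C₂ |x|^{-s₂}` on `C_K` with `s₁ < α < s₂`, then `(1 + |log|x||)^β |x|^α φ(x)` is bounded for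
every `β`. [folklore] -/
theorem exists_logWeight_mul_rpow_mul_le (β : ℕ) {α s₁ s₂ C₁ C₂ : ℝ} (h₁ : s₁ < α) (h₂ : α < s₂)
    {φ : IdeleClassGroup K → ℝ} (hφ : ∀ x, 0 ≤ φ x)
    (hb₁ : ∀ x, φ x ≤ C₁ * classNorm K x ^ (-s₁)) (hb₂ : ∀ x, φ x ≤ C₂ * classNorm K x ^ (-s₂)) :
    ∃ B : ℝ, ∀ x, logWeight K β x * (classNorm K x ^ α * φ x) ≤ B := by
  set ε : ℝ := min (α - s₁) (s₂ - α) with hε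
  have hε0 : 0 < ε := lt_min (by linarith) (by linarith)
  obtain ⟨A₁, hA₁⟩ := exists_one_add_log_pow_mul_rpow_le β hε0
  obtain ⟨A₂, hA₂⟩ := exists_one_add_log_pow_mul_rpow_neg_le β hε0
  refine ⟨max (C₁ * A₁) (C₂ * A₂), fun x => ?_⟩
  have ht0 : 0 < classNorm K x := classNorm_pos x
  set t : ℝ := classNorm K x with ht
  have hw0 : 0 ≤ logWeight K β x := logWeight_nonneg β x
  have hwdef : logWeight K β x = (1 + |Real.log t|) ^ β := rfl
  rcases le_total t 1 with ht1 | ht1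
  · -- `t ≤ 1`: use the bound with `s₁`
    have hC₁ : 0 ≤ C₁ := by
      have h := (hφ x).trans (hb₁ x)
      exact nonneg_of_mul_nonneg_left h (Real.rpow_pos_of_pos ht0 _)
    have hexp : t ^ α * t ^ (-s₁) ≤ t ^ ε := by
      rw [← Real.rpow_add ht0]
      exact Real.rpow_le_rpow_of_exponent_ge ht0 ht1 ((min_le_left _ _).trans (by linarith))
    calc logWeight K β x * (t ^ α * φ x)
        ≤ logWeight K β x * (t ^ α * (C₁ * t ^ (-s₁))) :=
          mul_le_mul_of_nonneg_left (mul_le_mul_of_nonneg_left (hb₁ x) (Real.rpow_nonneg ht0.le _)) hw0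
      _ = C₁ * (logWeight K β x * (t ^ α * t ^ (-s₁))) := by ring
      _ ≤ C₁ * (logWeight K β x * t ^ ε) :=
          mul_le_mul_of_nonneg_left (mul_le_mul_of_nonneg_left hexp hw0) hC₁
      _ ≤ C₁ * A₁ := mul_le_mul_of_nonneg_left (by rw [hwdef]; exact hA₁ t ht0 ht1) hC₁
      _ ≤ max (C₁ * A₁) (C₂ * A₂) := le_max_left _ _
  · -- `1 ≤ t`: use the bound with `s₂`
    have hC₂ : 0 ≤ C₂ := by
      have h := (hφ x).trans (hb₂ x)
      exact nonneg_of_mul_nonneg_left h (Real.rpow_pos_of_pos ht0 _)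
    have hexp : t ^ α * t ^ (-s₂) ≤ t ^ (-ε) := by
      rw [← Real.rpow_add ht0]
      refine Real.rpow_le_rpow_of_exponent_le ht1 ?_
      have := min_le_right (α - s₁) (s₂ - α)
      linarith
    calc logWeight K β x * (t ^ α * φ x)
        ≤ logWeight K β x * (t ^ α * (C₂ * t ^ (-s₂))) :=
          mul_le_mul_of_nonneg_left (mul_le_mul_of_nonneg_left (hb₂ x) (Real.rpow_nonneg ht0.le _)) hw0
      _ = C₂ * (logWeight K β x * (t ^ α * t ^ (-s₂))) := by ring
      _ ≤ C₂ * (logWeight K β x * t ^ (-ε)) :=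
          mul_le_mul_of_nonneg_left (mul_le_mul_of_nonneg_left hexp hw0) hC₂
      _ ≤ C₂ * A₂ := mul_le_mul_of_nonneg_left (by rw [hwdef]; exact hA₂ t ht1) hC₂
      _ ≤ max (C₁ * A₁) (C₂ * A₂) := le_max_right _ _

end LogWeight

/-! ### The criterion for `f · |x|^α ∈ 𝒮(C_K)` -/

section Criterion

variable {K}

/-- **Criterion for membership of `f · |x|^α` in `𝒮(C_K)`.** Suppose `f · |x|^α` is invariant under
an open subgroup of the finite idele units, the archimedean orbit maps `X ↦ f(x exp X)` are smooth
at `X = 0` for all `x`, and for every order `n` their `n`-th derivatives at `0` are bounded by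
`C₁ |x|^{-s₁}` and by `C₂ |x|^{-s₂}` for some `s₁ < α < s₂`. Then `f · |x|^α` is a Bruhat–Schwartz
function on `C_K` (the form in which Meyer's Lemma 5.3, `Σ(𝒮(𝔸_K)) ⊆ 𝒮(C_K)_{(1,∞)}`, is proved
from theta-series estimates). [folklore] -/
theorem weightMul_mem_ideleClassSchwartz_of_bounds {f : IdeleClassGroup K → ℂ} {α : ℝ}
    (hU : ∃ U : OpenSubgroup (FiniteAdeleRing (𝓞 K) K)ˣ, ∀ u ∈ U, ∀ x : IdeleClassGroup K,
      weightMul K α f (x * finiteUnitClass K u) = weightMul K α f x)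
    (hs : ∀ x, ContDiffAt ℝ ∞ (archOrbit K f x) 0)
    (hd : ∀ n : ℕ, ∃ s₁ s₂ C₁ C₂ : ℝ, s₁ < α ∧ α < s₂ ∧ ∀ x : IdeleClassGroup K,
      ‖iteratedFDeriv ℝ n (archOrbit K f x) 0‖ ≤ C₁ * classNorm K x ^ (-s₁) ∧
        ‖iteratedFDeriv ℝ n (archOrbit K f x) 0‖ ≤ C₂ * classNorm K x ^ (-s₂)) :
    weightMul K α f ∈ ideleClassSchwartz K := by
  have hsm : ∀ x, ContDiff ℝ ∞ (archOrbit K f x) := contDiff_archOrbit_of_contDiffAt_zero hs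
  refine ⟨hU, fun x => contDiff_archOrbit_weightMul (hsm x) α, fun n β => ?_⟩
  obtain ⟨C, hC0, hC⟩ := exists_norm_iteratedFDeriv_archOrbit_weightMul_le K α n
  -- a uniform bound for each order `i ≤ n`
  have hB : ∀ i : ℕ, ∃ B : ℝ, ∀ x : IdeleClassGroup K,
      logWeight K β x * (classNorm K x ^ α * ‖iteratedFDeriv ℝ i (archOrbit K f x) 0‖) ≤ B := by
    intro i
    obtain ⟨s₁, s₂, C₁, C₂, h₁, h₂, hb⟩ := hd i
    exact exists_logWeight_mul_rpow_mul_le β h₁ h₂ (fun x => norm_nonneg _) (fun x => (hb x).1)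
      fun x => (hb x).2
  choose B hB using hB
  refine ⟨C * ∑ i ∈ Finset.range (n + 1), B i, fun x => ?_⟩
  have hw0 : 0 ≤ logWeight K β x := logWeight_nonneg β x
  calc logWeight K β x * ‖iteratedFDeriv ℝ n (archOrbit K (weightMul K α f) x) 0‖
      ≤ logWeight K β x * (classNorm K x ^ α *
          (C * ∑ i ∈ Finset.range (n + 1), ‖iteratedFDeriv ℝ i (archOrbit K f x) 0‖)) :=
        mul_le_mul_of_nonneg_left (hC f x (hsm x)) hw0
    _ = C * ∑ i ∈ Finset.range (n + 1),
          logWeight K β x * (classNorm K x ^ α * ‖iteratedFDeriv ℝ i (archOrbit K f x) 0‖) := by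
        rw [Finset.mul_sum, Finset.mul_sum, Finset.mul_sum, Finset.mul_sum]
        refine Finset.sum_congr rfl fun i _ => ?_
        ring
    _ ≤ C * ∑ i ∈ Finset.range (n + 1), B i :=
        mul_le_mul_of_nonneg_left (Finset.sum_le_sum fun i _ => hB i x) hC0

/-- A Bruhat–Schwartz function has bounded orbit derivatives of every order: the case `β = 0` of the
decay condition. [folklore] -/
theorem IsIdeleClassSchwartz.exists_norm_iteratedFDeriv_le {f : IdeleClassGroup K → ℂ}
    (hf : IsIdeleClassSchwartz K f) (n : ℕ) :
    ∃ C : ℝ, ∀ x : IdeleClassGroup K, ‖iteratedFDeriv ℝ n (archOrbit K f x) 0‖ ≤ C := by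
  obtain ⟨C, hC⟩ := hf.decay n 0
  refine ⟨C, fun x => ?_⟩
  have h := hC x
  rwa [show logWeight K 0 x = 1 from pow_zero _, one_mul] at h

end Criterion

/-! ### Inversion, `J`, and interpolation -/

section Inversion

variable {K}

/-- The weights are symmetric under inversion: `(1 + |log|x⁻¹||)^β = (1 + |log|x||)^β`. [folklore] -/
theorem logWeight_inv (β : ℕ) (x : IdeleClassGroup K) : logWeight K β x⁻¹ = logWeight K β x := by
  unfold logWeight classNorm
  rw [map_inv, NNReal.coe_inv, Real.log_inv, abs_neg]

/-- **`𝒮(C_K)` is stable under `f ↦ f(x⁻¹)`.** [folklore] -/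
theorem IsIdeleClassSchwartz.comp_inv {f : IdeleClassGroup K → ℂ} (hf : IsIdeleClassSchwartz K f) :
    IsIdeleClassSchwartz K fun y => f y⁻¹ where
  exists_openSubgroup := by
    obtain ⟨U, hU⟩ := hf.exists_openSubgroup
    refine ⟨U, fun u hu x => ?_⟩
    have hxu : (x * finiteUnitClass K u)⁻¹ = x⁻¹ * finiteUnitClass K u⁻¹ := by
      rw [map_inv]
      exact mul_inv x (finiteUnitClass K u)
    rw [hxu]
    exact hU u⁻¹ (inv_mem hu) x⁻¹
  contDiff x := by
    rw [archOrbit_comp_inv]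
    exact (hf.contDiff x⁻¹).comp contDiff_neg
  decay n β := by
    obtain ⟨C, hC⟩ := hf.decay n β
    refine ⟨C, fun x => ?_⟩
    rw [archOrbit_comp_inv, show (Neg.neg : mixedSpace K → mixedSpace K) =
      (LinearIsometryEquiv.neg ℝ : mixedSpace K ≃ₗᵢ[ℝ] mixedSpace K) from
        (LinearIsometryEquiv.coe_neg (R := ℝ) (E := mixedSpace K)).symm,
      LinearIsometryEquiv.norm_iteratedFDeriv_comp_right, map_zero, ← logWeight_inv β x]
    exact hC x⁻¹

/-- `(J f) · |x|^α = (f · |x|^{1-α})(x⁻¹)`: `|x|⁻¹ f(x⁻¹) |x|^α = f(x⁻¹) |x⁻¹|^{1-α}`.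
[cite: Meyer2005, §1 p. 4] -/
theorem weightMul_invJ (α : ℝ) (f : IdeleClassGroup K → ℂ) :
    weightMul K α (invJ K f) = fun x => weightMul K (1 - α) f x⁻¹ := by
  funext x
  rw [weightMul_apply, invJ_apply, weightMul_apply]
  unfold classNorm
  rw [map_inv, NNReal.coe_inv, Real.inv_rpow (NNReal.coe_nonneg _), ← Real.rpow_neg (NNReal.coe_nonneg _),
    neg_sub, Real.rpow_sub (classNorm_pos x), Real.rpow_one]
  have h0 : ((classNorm K x : ℝ) : ℂ) ≠ 0 := Complex.ofReal_ne_zero.2 (classNorm_ne_zero x)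
  change ((classNorm K x : ℝ) : ℂ)⁻¹ * f x⁻¹ * ((classNorm K x ^ α : ℝ) : ℂ) =
    f x⁻¹ * (((classNorm K x ^ α / classNorm K x : ℝ)) : ℂ)
  push_cast
  field_simp

/-- **`J` maps `𝒮(C_K)_{(1,∞)}` into `𝒮(C_K)_{(-∞,0)}`** (Meyer (2005), proof of Lemma 5.4 and of
Lemma 5.6: "`J : 𝒮(C_S)₊ ≅ 𝒮(C_S)₋` is a bornological isomorphism"; here only the algebraic
inclusion). [cite: Meyer2005, Lemma 5.4 (proof)] -/
theorem invJ_mem_ideleClassSchwartzWeighted_Iio {f : IdeleClassGroup K → ℂ}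
    (hf : f ∈ ideleClassSchwartzWeighted K (Set.Ioi 1)) :
    invJ K f ∈ ideleClassSchwartzWeighted K (Set.Iio 0) := by
  rw [mem_ideleClassSchwartzWeighted_iff] at hf ⊢
  intro α hα
  rw [weightMul_invJ]
  have h1 : 1 < 1 - α := by rw [Set.mem_Iio] at hα; linarith
  exact IsIdeleClassSchwartz.comp_inv (hf (1 - α) h1)

/-- Invariance of a weighted function under a finite idele unit, from the invariance of two
different weightings: if `g(xu) = g(x)` and `(g·|·|^{c})(xu) = (g·|·|^{c})(x)` with `c ≠ 0`, then
`(g·|·|^γ)(xu) = (g·|·|^γ)(x)` for every `γ`. [folklore] -/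
theorem weightMul_apply_mul_eq_of_two_weights {g : IdeleClassGroup K → ℂ} {c : ℝ} (hc : c ≠ 0)
    {x y : IdeleClassGroup K} (h0 : g y = g x) (h1 : weightMul K c g y = weightMul K c g x) (γ : ℝ) :
    weightMul K γ g y = weightMul K γ g x := by
  rw [weightMul_apply, weightMul_apply, h0] at h1 ⊢
  by_cases hg : g x = 0
  · rw [hg, zero_mul, zero_mul]
  · have h2 : ((classNorm K y ^ c : ℝ) : ℂ) = ((classNorm K x ^ c : ℝ) : ℂ) := mul_left_cancel₀ hg h1
    have h3 : classNorm K y ^ c = classNorm K x ^ c := by exact_mod_cast h2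
    have h4 : classNorm K y = classNorm K x :=
      Real.rpow_left_injOn hc (Set.mem_setOf.2 (classNorm_pos y).le)
        (Set.mem_setOf.2 (classNorm_pos x).le) h3
    rw [h4]

/-- **Interpolation of the weighted Schwartz spaces**: `𝒮(C_K)_{(1,∞)} ∩ 𝒮(C_K)_{(-∞,0)} ⊆
𝒮(C_K)_ℝ = H₋` (Meyer (2005), §4.1: the spaces `𝒮(G)_I` only depend on the interval spanned by `I`;
for `α ∈ [0,1]` the missing weight `|x|^α` is dominated by `|x|^{2}` for `|x| ≥ 1` and by `|x|^{-1}`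
for `|x| ≤ 1`, derivatives included by the Leibniz bound). [cite: Meyer2005, §4.1] -/
theorem mem_Hminus_of_mem_weighted_Ioi_of_mem_weighted_Iio {f : IdeleClassGroup K → ℂ}
    (hf₁ : f ∈ ideleClassSchwartzWeighted K (Set.Ioi 1))
    (hf₂ : f ∈ ideleClassSchwartzWeighted K (Set.Iio 0)) : f ∈ Hminus K := by
  rw [mem_ideleClassSchwartzWeighted_iff] at hf₁ hf₂ ⊢
  intro α _
  by_cases hα1 : 1 < α
  · exact hf₁ α hα1
  by_cases hα0 : α < 0
  · exact hf₂ α hα0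
  push Not at hα1 hα0
  -- `g = f·|x|²` and `h = f·|x|⁻¹ = g·|x|⁻³` are Bruhat–Schwartz
  have hg : IsIdeleClassSchwartz K (weightMul K 2 f) := hf₁ 2 (by norm_num)
  have hh : IsIdeleClassSchwartz K (weightMul K (-3) (weightMul K 2 f)) := by
    rw [weightMul_weightMul, show (-3 : ℝ) + 2 = -1 by norm_num]
    exact hf₂ (-1) (by norm_num)
  have hfg : weightMul K α f = weightMul K (α - 2) (weightMul K 2 f) := by
    rw [weightMul_weightMul, sub_add_cancel]
  rw [hfg]
  refine weightMul_mem_ideleClassSchwartz_of_bounds ?_ (fun x => (hg.contDiff x).contDiffAt) fun n => ?_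
  · obtain ⟨U₁, hU₁⟩ := hg.exists_openSubgroup
    obtain ⟨U₂, hU₂⟩ := hh.exists_openSubgroup
    refine ⟨U₁ ⊓ U₂, fun u hu x => ?_⟩
    exact weightMul_apply_mul_eq_of_two_weights (by norm_num) (hU₁ u hu.1 x) (hU₂ u hu.2 x) (α - 2)
  · -- the bound `O(|x|^{3})` from `h`, and `O(1)` from `g`
    obtain ⟨C, hC0, hC⟩ := exists_norm_iteratedFDeriv_archOrbit_weightMul_le K 3 n
    have hA : ∀ i : ℕ, ∃ A : ℝ, ∀ x : IdeleClassGroup K,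
        ‖iteratedFDeriv ℝ i (archOrbit K (weightMul K (-3) (weightMul K 2 f)) x) 0‖ ≤ A :=
      fun i => hh.exists_norm_iteratedFDeriv_le i
    choose A hA using hA
    obtain ⟨C₂, hC₂⟩ := hg.exists_norm_iteratedFDeriv_le n
    refine ⟨-3, 0, C * ∑ i ∈ Finset.range (n + 1), A i, C₂, by linarith, by linarith, fun x => ⟨?_, ?_⟩⟩
    · have hgw : weightMul K 2 f = weightMul K 3 (weightMul K (-3) (weightMul K 2 f)) := by
        rw [weightMul_weightMul, show (3 : ℝ) + -3 = 0 by norm_num, weightMul_zero_eq]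
      have h := hC (weightMul K (-3) (weightMul K 2 f)) x (hh.contDiff x)
      rw [← hgw] at h
      refine h.trans ?_
      rw [neg_neg, mul_comm (C * _) (classNorm K x ^ (3 : ℝ))]
      refine mul_le_mul_of_nonneg_left ?_ (Real.rpow_nonneg (classNorm_pos x).le _)
      exact mul_le_mul_of_nonneg_left (Finset.sum_le_sum fun i _ => hA i x) hC0
    · rw [neg_zero, Real.rpow_zero, mul_one]
      exact hC₂ x

end Inversion

end Literature.NumberTheory.Automorphic.Meyer
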